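import Mathlib.GroupTheory.Nilpotent
import Mathlib.GroupTheory.QuotientGroup.Basic
import Mathlib.GroupTheory.FreeGroup.Basic
import Literature.Topology.FourManifolds.GroupTrisections
import Literature.Algebra.Lie.SurfaceLieAlgebra
import HarnessLib
import Summits.SmoothPoincare4.SmoothPoincare4.Theorems.CongruenceShadowsNilpotentShadowsStandardTorsorCalculus

/-!
# Level-one glue II: the cut dictionary (helper for stub `stub_levelOneGlue`)

Line `saturated-torsor-descent`, crux `CongruenceShadows.NilpotentShadowsStandard`
(item stmt-SmoothPoincare4-14594).  For a *cut pattern* `ct : Fin g → Bool` on the letters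
`Fin g × Bool` of `S_g = Literature.Topology.FourManifolds.SurfaceGroup g` (one cut letter
`(h, ct h)` and one survivor `(h, !ct h)` per handle `h`):
* the **erasing projection** `π : S_g →* FreeGroup (Fin g)`, cut letters `↦ 1`, survivor of
  handle `h ↦ FreeGroup.of h`, is onto with kernel the normal closure of the cut letters
  (`exists_erasePi`, from the tree's `quotientEquivFreeGroupErase`);
* the s4 cut systems `Literature.Algebra.Lie.s4CutSystem m i` are cut patterns (`exists_s4Cut`),
  registered together as `helper_glueErasePi`;
* **target transport**: for `w ∈ γ₂ S` and such a `π` whose kernel has no hidden depth,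
  `π w ∈ γ₃ F` implies `w ∈ ⁅ker π, S⁆ γ₃ S` (`mem_commutator_sup_of_map_mem`);
* bookkeeping: the surface relation handle by handle in cut/survivor form, images of kernels.
No definitions.
-/

set_option linter.dupNamespace false

open Subgroup Literature.Topology.FourManifolds Literature.Algebra.Lie
open scoped commutatorElement

namespace Summit.SmoothPoincare4.SmoothPoincare4.Theorems.NilpotentShadowsStandard.SaturatedTorsorDescent

/-! ## The erasing projection of a cut pattern -/

section Erase

variable {g : ℕ}

/-- **The erasing projection of a cut pattern.** For `ct : Fin g → Bool` and the normal closure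
`N` of the cut letters `(h, ct h)`, there is a surjection `π : S_g ↠ FreeGroup (Fin g)` with kernel
`N` sending the cut letter of each handle to `1` and its survivor `(h, !ct h)` to the free
generator `h`. [folklore] -/
theorem exists_erasePi (ct : Fin g → Bool) (N : Subgroup (SurfaceGroup g))
    (hN : N = normalClosure (PresentedGroup.of '' {x : Fin g × Bool | x.2 = ct x.1})) :
    ∃ π : SurfaceGroup g →* FreeGroup (Fin g), Function.Surjective π ∧ π.ker = N ∧
      ∀ (h : Fin g) (b : Bool), π (PresentedGroup.of (h, b)) = if b = ct h then 1 else FreeGroup.of h := by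
  classical
  subst hN
  set C : Finset (surfaceGen g) := Finset.univ.filter fun x => x.2 = ct x.1 with hC
  have hmemC : ∀ x : surfaceGen g, x ∈ C ↔ x.2 = ct x.1 := fun x => by simp [hC]
  have hS : ∀ h : Fin g, (h, false) ∈ C ∨ (h, true) ∈ C := fun h => by
    cases hb : ct h
    · exact Or.inl ((hmemC _).2 hb.symm)
    · exact Or.inr ((hmemC _).2 hb.symm)
  set N := normalClosure (PresentedGroup.of '' {x : Fin g × Bool | x.2 = ct x.1} :
    Set (SurfaceGroup g)) with hN
  have hN₁ : ∀ x ∈ C, (PresentedGroup.of x : SurfaceGroup g) ∈ N := fun x hx =>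
    subset_normalClosure ⟨x, (hmemC x).1 hx, rfl⟩
  have hN₂ : N ≤ (eraseHom C hS).ker := by
    refine normalClosure_le_normal ?_
    rintro _ ⟨x, hx, rfl⟩
    exact of_mem_ker_eraseHom C hS ((hmemC x).2 hx)
  -- survivors ↔ handles
  set e : {x : surfaceGen g // x ∉ C} ≃ Fin g :=
    { toFun := fun x => x.1.1
      invFun := fun h => ⟨(h, !ct h), fun hh => by
        have := (hmemC _).1 hh
        cases hb : ct h <;> simp [hb] at this⟩
      left_inv := by
        rintro ⟨⟨h, b⟩, hx⟩
        have hb : ¬ b = ct h := fun hb => hx ((hmemC _).2 hb)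
        ext
        · rfl
        · cases b <;> cases hc : ct h <;> simp_all
      right_inv := fun h => rfl } with he
  set ε := (quotientEquivFreeGroupErase C hS N hN₁ hN₂).trans (FreeGroup.freeGroupCongr e) with hε
  have hval : ∀ s : SurfaceGroup g, ε.toMonoidHom.comp (QuotientGroup.mk' N) s =
      FreeGroup.freeGroupCongr e (eraseHom C hS s) := fun s => rfl
  refine ⟨ε.toMonoidHom.comp (QuotientGroup.mk' N), ?_, ?_, fun h b => ?_⟩
  · exact ε.surjective.comp (QuotientGroup.mk'_surjective N)
  · rw [MulEquiv.toMonoidHom_eq_coe, MonoidHom.ker_mulEquiv_comp, QuotientGroup.ker_mk']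
  · rw [hval, eraseHom_of]
    by_cases hb : b = ct h
    · rw [eraseGen_of_mem ((hmemC _).2 hb), map_one, if_pos hb]
    · rw [eraseGen_of_not_mem (fun hh => hb ((hmemC _).1 hh)), FreeGroup.freeGroupCongr_apply,
        FreeGroup.map.of, if_neg hb]
      rfl

/-- The s4 cut systems are cut patterns: `(h, b) ∈ s4CutSystem m i ↔ b = ct h` for the pattern
`ct h = [((h mod 3), true) ∈ s4Gens i]`. [folklore] -/
theorem exists_s4Cut (m : ℕ) (i : Fin 3) :
    ∃ ct : Fin (3 + 3 * m) → Bool, ∀ (h : Fin (3 + 3 * m)) (b : Bool), ((h, b) ∈ s4CutSystem m i ↔ b = ct h) := by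
  refine ⟨fun h => decide ((((⟨(h : ℕ) % 3, Nat.mod_lt _ (by decide)⟩ : Fin 3)), true) ∈ s4Gens i),
    fun h b => ?_⟩
  simp only [s4CutSystem, Set.mem_setOf_eq]
  generalize (⟨(h : ℕ) % 3, Nat.mod_lt _ (by decide)⟩ : Fin 3) = k
  fin_cases i <;> fin_cases k <;> cases b <;> decide

/-- The cut system of a cut pattern as a set of letters. [folklore] -/
theorem setOf_cut_eq {m : ℕ} {i : Fin 3} {ct : Fin (3 + 3 * m) → Bool}
    (hct : ∀ (h : Fin (3 + 3 * m)) (b : Bool), ((h, b) ∈ s4CutSystem m i ↔ b = ct h)) :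
    s4CutSystem m i = {x : Fin (3 + 3 * m) × Bool | x.2 = ct x.1} := by
  ext ⟨h, b⟩
  exact hct h b

end Erase

/-! ## Target transport and kernel bookkeeping -/

section Transport

variable {g n : ℕ}

/-- A surjection maps `γₖ₊₁` onto `γₖ₊₁`. [folklore] -/
theorem map_lcs_eq_of_surjective {G M : Type*} [Group G] [Group M] (f : G →* M)
    (hf : Function.Surjective f) (k : ℕ) :
    ((⊤ : Subgroup G).lowerCentralSeries k).map f = (⊤ : Subgroup M).lowerCentralSeries k := by
  rw [map_lowerCentralSeries, ← MonoidHom.range_eq_map, MonoidHom.range_eq_top.2 hf]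

/-- Homomorphisms map `γₖ₊₁` into `γₖ₊₁`. [folklore] -/
theorem map_lcs_mem {G M : Type*} [Group G] [Group M] (f : G →* M) {k : ℕ} {x : G}
    (hx : x ∈ (⊤ : Subgroup G).lowerCentralSeries k) :
    f x ∈ (⊤ : Subgroup M).lowerCentralSeries k := by
  have h : ((⊤ : Subgroup G).lowerCentralSeries k).map f ≤ (⊤ : Subgroup M).lowerCentralSeries k := by
    rw [map_lowerCentralSeries]
    exact lowerCentralSeries_mono k le_top
  exact h (mem_map_of_mem f hx)

/-- **Target transport.** For a surjection `π : G ↠ M` whose kernel has no hidden depth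
(`ker π ⊓ γ₂ ≤ ⁅ker π, G⁆`) and `w ∈ γ₂ G`: if `π w ∈ γ₃ M` then `w ∈ ⁅ker π, G⁆ γ₃ G`.
[folklore] -/
theorem mem_commutator_sup_of_map_mem {G M : Type*} [Group G] [Group M] (π : G →* M)
    (hπ : Function.Surjective π)
    (hker : π.ker ⊓ (⊤ : Subgroup G).lowerCentralSeries 1 ≤ ⁅π.ker, (⊤ : Subgroup G)⁆)
    {w : G} (hw : w ∈ (⊤ : Subgroup G).lowerCentralSeries 1)
    (h : π w ∈ (⊤ : Subgroup M).lowerCentralSeries 2) :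
    w ∈ ⁅π.ker, (⊤ : Subgroup G)⁆ ⊔ (⊤ : Subgroup G).lowerCentralSeries 2 := by
  rw [← map_lcs_eq_of_surjective π hπ 2] at h
  obtain ⟨z, hz, hzw⟩ := h
  have h1 : w * z⁻¹ ∈ π.ker := by
    rw [MonoidHom.mem_ker, map_mul, map_inv, hzw, mul_inv_cancel]
  have h2 : w * z⁻¹ ∈ π.ker ⊓ (⊤ : Subgroup G).lowerCentralSeries 1 :=
    mem_inf.2 ⟨h1, mul_mem hw (inv_mem (lcs_antitone (by decide) hz))⟩
  have e : w = (w * z⁻¹) * z := by rw [inv_mul_cancel_right]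
  rw [e]
  exact mul_mem (mem_sup_left (hker h2)) (mem_sup_right hz)

/-- The quotient by the kernel of a surjection onto `FreeGroup (Fin n)` is free of rank `n`.
[folklore] -/
theorem isFreeOfRank_quotient_ker {G : Type*} [Group G] (π : G →* FreeGroup (Fin n))
    (hπ : Function.Surjective π) : IsFreeOfRank (G ⧸ π.ker) n :=
  ⟨(QuotientGroup.quotientKerEquivOfSurjective π hπ).symm⟩

/-- For normal `A`, `B`: `⟪A ∪ B⟫ = A ⊔ B`. [folklore] -/
theorem normalClosure_union_eq_sup {G : Type*} [Group G] (A B : Subgroup G) [A.Normal] [B.Normal] :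
    normalClosure ((A : Set G) ∪ B) = A ⊔ B := by
  refine le_antisymm (normalClosure_le_normal (Set.union_subset ?_ ?_)) (sup_le ?_ ?_)
  · exact fun x hx => mem_sup_left hx
  · exact fun x hx => mem_sup_right hx
  · exact fun x hx => subset_normalClosure (Set.mem_union_left _ hx)
  · exact fun x hx => subset_normalClosure (Set.mem_union_right _ hx)

/-- **Pair bookkeeping.** For normal `Q` without hidden depth and `Q ≤ P ⊔ γ₂` (`P` normal):
`Q ⊓ γ₂ ≤ ⁅P, ⊤⁆ ⊔ γ₃`. [folklore] -/
theorem inf_lcs_le_commutator_sup {G : Type*} [Group G] (Q P : Subgroup G) [Q.Normal]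
    [P.Normal] (hQ : Q ⊓ (⊤ : Subgroup G).lowerCentralSeries 1 ≤ ⁅Q, (⊤ : Subgroup G)⁆)
    (hQP : Q ≤ P ⊔ (⊤ : Subgroup G).lowerCentralSeries 1) :
    Q ⊓ (⊤ : Subgroup G).lowerCentralSeries 1 ≤ ⁅P, (⊤ : Subgroup G)⁆ ⊔ (⊤ : Subgroup G).lowerCentralSeries 2 := by
  refine hQ.trans ((commutator_mono hQP le_rfl).trans ((commutator_sup_top_le P _).trans ?_))
  exact le_rfl

/-- A homomorphism killing the normal subgroup `P` maps `⁅P, ⊤⁆ ⊔ γ₃` into `γ₃`. [folklore] -/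
theorem map_commutator_sup_lcs_le {G M : Type*} [Group G] [Group M] (f : G →* M) (P : Subgroup G)
    (hP : P ≤ f.ker) :
    (⁅P, (⊤ : Subgroup G)⁆ ⊔ (⊤ : Subgroup G).lowerCentralSeries 2).map f ≤
      (⊤ : Subgroup M).lowerCentralSeries 2 := by
  rw [Subgroup.map_sup, map_commutator, (Subgroup.map_eq_bot_iff P).2 hP, commutator_bot_left, bot_sup_eq,
    map_lowerCentralSeries]
  exact lowerCentralSeries_mono 2 le_top

end Transport

/-! ## The surface relation in cut/survivor form -/

section Relation

variable {g : ℕ}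

/-- Handle by handle, `⁅a_h, b_h⁆ = ⁅x_h, y_h⁆ ^ s_h` for the cut letter `x_h = (h, ct h)`, the
survivor `y_h = (h, !ct h)` and the sign `s_h = if ct h then -1 else 1`. [folklore] -/
theorem handle_commutator_eq (ct : Fin g → Bool) (h : Fin g) :
    genA h * genB h * (genA h)⁻¹ * (genB h)⁻¹ =
      ⁅(FreeGroup.of (h, ct h) : FreeGroup (surfaceGen g)), FreeGroup.of (h, !ct h)⁆ ^
        (if ct h then (-1 : ℤ) else 1) := by
  cases ct h
  · simp [genA, genB, commutatorElement_def, mul_assoc]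
  · simp only [Bool.not_true, ite_true, zpow_neg, zpow_one, genA, genB, commutatorElement_def]
    group

/-- **The surface relation in cut/survivor form**: under any homomorphism `ρ` out of `S_g`,
`∏_h ⁅ρ x_h, ρ y_h⁆ ^ s_h = 1`. [folklore] -/
theorem prod_handle_commutators_eq_one {M : Type*} [Group M] (ct : Fin g → Bool)
    (ρ : SurfaceGroup g →* M) :
    ((List.finRange g).map fun h => ⁅ρ (PresentedGroup.of (h, ct h)), ρ (PresentedGroup.of (h, !ct h))⁆ ^
      (if ct h then (-1 : ℤ) else 1)).prod = 1 := by
  have hsr : surfaceRelator g = ((List.finRange g).map fun h =>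
      ⁅(FreeGroup.of (h, ct h) : FreeGroup (surfaceGen g)), FreeGroup.of (h, !ct h)⁆ ^
        (if ct h then (-1 : ℤ) else 1)).prod :=
    congrArg List.prod (List.map_congr_left fun h _ => handle_commutator_eq ct h)
  have hrel : ρ.comp (PresentedGroup.mk {surfaceRelator g}) (((List.finRange g).map fun h =>
      ⁅(FreeGroup.of (h, ct h) : FreeGroup (surfaceGen g)), FreeGroup.of (h, !ct h)⁆ ^
        (if ct h then (-1 : ℤ) else 1)).prod) = 1 := by
    rw [← hsr, MonoidHom.comp_apply, PresentedGroup.one_of_mem (Set.mem_singleton _), map_one]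
  rw [map_list_prod, List.map_map] at hrel
  rw [← hrel]
  refine congrArg List.prod (List.map_congr_left fun h _ => ?_)
  simp only [Function.comp_apply, map_zpow, map_commutatorElement, MonoidHom.comp_apply]
  rfl

end Relation

/-! ## Registered helper -/

/-- **Registered helper `helper_glueErasePi`** (sub-goal of the lead's skeleton for crux
stmt-SmoothPoincare4-14594): every s4 cut system `s4CutSystem m i` is a cut pattern `ct`, and —
granted the cut normal form `stabilizeIter m i = ⟪of '' s4CutSystem m i⟫` (the landed
`stub_cutNormalForm`) — the erasing projection `S_{3+3m} ↠ FreeGroup (Fin (3+3m))` (cut letters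
`↦ 1`, survivor of handle `h ↦ of h`) exists, is onto and has kernel `stabilizeIter m i`. [folklore] -/
theorem helper_glueErasePi : ∀ (m : ℕ) (i : Fin 3), Literature.Topology.FourManifolds.s4Kernels.stabilizeIter m i = Subgroup.normalClosure (PresentedGroup.of '' Literature.Algebra.Lie.s4CutSystem m i) → ∃ ct : Fin (3 + 3 * m) → Bool, ∃ π : Literature.Topology.FourManifolds.SurfaceGroup (3 + 3 * m) →* FreeGroup (Fin (3 + 3 * m)), (∀ (h : Fin (3 + 3 * m)) (b : Bool), ((h, b) ∈ Literature.Algebra.Lie.s4CutSystem m i ↔ b = ct h)) ∧ Function.Surjective π ∧ π.ker = Literature.Topology.FourManifolds.s4Kernels.stabilizeIter m i ∧ ∀ (h : Fin (3 + 3 * m)) (b : Bool), π (PresentedGroup.of (h, b)) = if b = ct h then 1 else FreeGroup.of h := by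
  intro m i hN
  obtain ⟨ct, hct⟩ := exists_s4Cut m i
  rw [setOf_cut_eq hct] at hN
  obtain ⟨π, h1, h2, h3⟩ := exists_erasePi ct _ hN
  exact ⟨ct, π, hct, h1, h2, h3⟩

end Summit.SmoothPoincare4.SmoothPoincare4.Theorems.NilpotentShadowsStandard.SaturatedTorsorDescent
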